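import Literature.Algebra.Lie.LefschetzTripleFactors
import Literature.Algebra.Lie.LefschetzModuleJordanType
import HarnessLib

/-!
# Jordan–Lefschetz pairs pass to surjective images and to ideal factors (Looijenga–Lunts 1997, (1.2), §2)

Topic `Literature/Algebra/Lie` (namespace `Literature.Algebra.Lie`).  Lane `lit-hodgefound` (Track 2 foundations library),
skeleton seat `lit-hodgefound-skel-1` (generation 51), row **A1-200** of `run/shared/lean/pub/lit-hodgefound/SKELETON.md`;
the Jordan companion of row A1-136 (`LefschetzTripleFactors.lean`: `IsLefschetzTriple.map_of_surjective`,
`IsLefschetzTriple.map_lieIdealProj`) and of row A1-199 (`IsJordanLefschetzPair.prod`): together they reduce a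
semisimple Jordan–Lefschetz pair to its simple factors and reassemble it — the step "In what follows, `(𝔤, h)` is a
Jordan–Lefschetz pair with `𝔤` simple" of the classification (2.6).  THEOREMS ONLY (no definition, no named fact, no
`sorry`; net debt `0`).

## Source, VERBATIM

E. Looijenga, V. A. Lunts, *A Lie algebra attached to a projective variety*, Invent. Math. **129** (1997) 361–412 (held
TeX `paper:arxiv-alg-geom_9604014`): §1 (1.2) Lemma and proof, p0004 L94–L105 ("`𝔤^{(i)}` gets a grading from
`ad_{h^{(i)}}` … if `f` is written `(f', f'')`, then `[h, f] = -2f` implies `[h', f'] = -2f'`"); §2 p0009 L108–L110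
("a Lefschetz pair `(𝔤, h)` is a Jordan–Lefschetz pair if `(𝔤, h, 𝔤_2)` is a Lefschetz triple"), (2.2) p0009 L112–L119
("`𝔤 = 𝔤_{-2} ⊕ 𝔤_0 ⊕ 𝔤_2`"), p0009 L131 ("In what follows, `(𝔤, h)` is a Jordan–Lefschetz pair with `𝔤` simple"),
(2.6) p0010 L28–L31 ("every item of this list determines an isomorphism class of Jordan–Lefschetz pairs").

## Contents (all proved; `K` of characteristic `0`, `𝔤`, `𝔤'` finite-dimensional)

* `apply_mem_adDegree_of_mem` (`φ 𝔤_c ⊆ 𝔤'_c(φ h)` for any Lie homomorphism `φ`);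
* **`IsJordanLefschetzPair.adDegree_map_eq_bot_of_surjective`**: for a Jordan–Lefschetz pair `(𝔤, h)` and a SURJECTIVE
  `φ : 𝔤 → 𝔤'`, `𝔤'_c(φ h) = 0` for `c ∉ {-2, 0, 2}` (from `𝔤 = 𝔤_{-2} ⊕ 𝔤_0 ⊕ 𝔤_2` and the independence of degrees);
* **`IsJordanLefschetzPair.map_adDegree_two_eq_of_surjective`**: `φ(𝔤_2) = 𝔤'_2(φ h)`;
* **`IsJordanLefschetzPair.map_of_surjective`**: `(𝔤', φ h)` is a Jordan–Lefschetz pair whenever `φ h ≠ 0` (row A1-136's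
  image triple `(𝔤', φ h, φ 𝔤_2)` has `𝔤'_4 = 0`, row A1-101 `isJordanLefschetzPair_of_adDegree_four_eq_bot`);
* **`IsJordanLefschetzPair.map_lieIdealProj`** (`_symm`): for `𝔤 = 𝔤' ⊕ 𝔤''` (complementary ideals, `𝔤' ≠ 0`) the factor
  `(𝔤', h')` is a Jordan–Lefschetz pair.
-/

namespace Literature.Algebra.Lie

open Function

variable {K : Type*} [Field K] [CharZero K] {L : Type*} [LieRing L] [LieAlgebra K L] [FiniteDimensional K L]
  {L' : Type*} [LieRing L'] [LieAlgebra K L'] [FiniteDimensional K L'] {h : L}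

omit [CharZero K] [FiniteDimensional K L] [FiniteDimensional K L'] in
/-- A Lie homomorphism maps `𝔤_c(h)` into `𝔤'_c(φ h)`. [cite: LooijengaLunts1997, §1 (1.2) proof p0004 L101–L105 ("[h, f] = -2f implies [h', f'] = -2f'")] -/
theorem apply_mem_adDegree_of_mem (φ : L →ₗ⁅K⁆ L') {x : L} {c : K} (hx : x ∈ adDegree K h c) :
    φ x ∈ adDegree K (φ h) c := by
  rw [mem_adDegree_iff, ← LieHom.map_lie, mem_adDegree_iff.1 hx, map_smul]

omit [FiniteDimensional K L'] in
/-- **Under a surjection the image grading has degrees `-2, 0, 2` only**: for a Jordan–Lefschetz pair `(𝔤, h)` and a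
surjective `φ : 𝔤 → 𝔤'`, `𝔤'_c(φ h) = 0` for `c ≠ -2, 0, 2` — every `y = φ x`, `x = x_{-2} + x_0 + x_2`, lies in
`𝔤'_{-2} + 𝔤'_0 + 𝔤'_2`, which meets `𝔤'_c` trivially. [cite: LooijengaLunts1997, §2 (2.2) p0009 L112–L119, §1 (1.2) proof p0004 L101–L105] -/
theorem IsJordanLefschetzPair.adDegree_map_eq_bot_of_surjective (J : IsJordanLefschetzPair K h) (φ : L →ₗ⁅K⁆ L')
    (hφ : Surjective φ) {c : K} (hc₁ : c ≠ -2) (hc₂ : c ≠ 0) (hc₃ : c ≠ 2) : adDegree K (φ h) c = ⊥ := by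
  rw [eq_bot_iff]
  intro y hy
  rw [Submodule.mem_bot]
  obtain ⟨x, rfl⟩ := hφ y
  obtain ⟨u, hu, v, hv, w, hw, rfl⟩ := J.exists_eq_add x
  let d : Option Bool → K := fun o ↦ o.elim 2 fun b ↦ cond b (-2) 0
  have hsum : φ (u + v + w) ∈ ⨆ i, adDegree K (φ h) (d i) := by
    rw [map_add, map_add]
    refine Submodule.add_mem _ (Submodule.add_mem _ ?_ ?_) ?_
    · exact Submodule.mem_iSup_of_mem (some true) (apply_mem_adDegree_of_mem φ hu)
    · exact Submodule.mem_iSup_of_mem (some false) (apply_mem_adDegree_of_mem φ hv)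
    · exact Submodule.mem_iSup_of_mem none (apply_mem_adDegree_of_mem φ hw)
  have hdisj := disjoint_adDegree_iSup (φ h) (d := d) (c := c) (by
    rintro (_ | _ | _)
    · exact hc₃.symm
    · exact hc₂.symm
    · exact hc₁.symm)
  exact Submodule.disjoint_def.1 hdisj _ hy hsum

omit [FiniteDimensional K L'] in
/-- **`φ` maps `𝔤_2` ONTO `𝔤'_2(φ h)`** (same argument in degree `2`: `y = φ x_{-2} + φ x_0 + φ x_2 ∈ 𝔤'_2` forces
`y = φ x_2`). [cite: LooijengaLunts1997, §2 (2.2) p0009 L112–L119, §1 (1.2) proof p0004 L101–L105] -/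
theorem IsJordanLefschetzPair.map_adDegree_two_eq_of_surjective (J : IsJordanLefschetzPair K h) (φ : L →ₗ⁅K⁆ L')
    (hφ : Surjective φ) : (adDegree K h 2).map (φ : L →ₗ[K] L') = adDegree K (φ h) 2 := by
  apply le_antisymm
  · rintro _ ⟨x, hx, rfl⟩
    exact apply_mem_adDegree_of_mem φ hx
  · intro y hy
    obtain ⟨x, rfl⟩ := hφ y
    obtain ⟨u, hu, v, hv, w, hw, rfl⟩ := J.exists_eq_add x
    -- `φ u + φ v = φ x - φ w ∈ 𝔤'_2 ∩ (𝔤'_{-2} + 𝔤'_0) = 0`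
    have h2 : φ u + φ v ∈ adDegree K (φ h) 2 := by
      have h1 := Submodule.sub_mem _ hy (apply_mem_adDegree_of_mem φ hw)
      rwa [map_add, map_add, add_sub_cancel_right] at h1
    have hsum : φ u + φ v ∈ ⨆ b : Bool, adDegree K (φ h) (cond b (-2 : K) 0) :=
      Submodule.add_mem _ (Submodule.mem_iSup_of_mem true (apply_mem_adDegree_of_mem φ hu))
        (Submodule.mem_iSup_of_mem false (apply_mem_adDegree_of_mem φ hv))
    have hdisj := disjoint_adDegree_iSup (φ h) (d := fun b : Bool ↦ cond b (-2 : K) 0) (c := 2)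
      (by rintro (_ | _) <;> norm_num)
    have h0 : φ u + φ v = 0 := Submodule.disjoint_def.1 hdisj _ h2 hsum
    refine ⟨w, hw, ?_⟩
    change φ w = φ (u + v + w)
    rw [map_add, map_add, h0, zero_add]

/-- **A surjective image of a Jordan–Lefschetz pair is a Jordan–Lefschetz pair**: `(𝔤, h)` Jordan–Lefschetz,
`φ : 𝔤 → 𝔤'` surjective with `φ h ≠ 0` ⟹ `(𝔤', φ h)` is Jordan–Lefschetz (the image triple `(𝔤', φ h, φ 𝔤_2)` of row
A1-136 is a Lefschetz triple, and `𝔤'_4(φ h) = 0`). [cite: LooijengaLunts1997, §1 (1.2) Lemma p0004 L94–L105, §2 p0009 L108–L119] -/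
theorem IsJordanLefschetzPair.map_of_surjective (J : IsJordanLefschetzPair K h) (φ : L →ₗ⁅K⁆ L') (hφ : Surjective φ)
    (h0 : φ h ≠ 0) : IsJordanLefschetzPair K (φ h) :=
  (J.isLefschetzTriple.map_of_surjective φ hφ h0).isJordanLefschetzPair_of_adDegree_four_eq_bot
    (J.adDegree_map_eq_bot_of_surjective φ hφ (by norm_num) (by norm_num) (by norm_num))

/-- Hence a surjective image with `φ h ≠ 0` of a Jordan–Lefschetz pair is (in particular) a Lefschetz pair.
[cite: LooijengaLunts1997, §1 (1.2) Lemma p0004 L94–L105] -/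
theorem IsJordanLefschetzPair.isLefschetzPair_map_of_surjective (J : IsJordanLefschetzPair K h) (φ : L →ₗ⁅K⁆ L')
    (hφ : Surjective φ) (h0 : φ h ≠ 0) : IsLefschetzPair K (φ h) :=
  (J.map_of_surjective φ hφ h0).isLefschetzPair

variable {I I' : LieIdeal K L}

/-- **The factors of a Jordan–Lefschetz pair are Jordan–Lefschetz pairs**: for `𝔤 = 𝔤' ⊕ 𝔤''` (complementary ideals)
with `𝔤' ≠ 0`, the `𝔤'`-component `h'` of `h` makes `(𝔤', h')` a Jordan–Lefschetz pair (`h' ≠ 0` by row A1-136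
`IsLefschetzTriple.lieIdealProj_h_ne_zero`).  With row A1-199 `IsJordanLefschetzPair.prod` this reduces Jordan–Lefschetz
pairs to the simple case treated by the classification. [cite: LooijengaLunts1997, §1 (1.2) Lemma p0004 L94–L105, §2 p0009 L131 ("(𝔤, h) is a Jordan–Lefschetz pair with 𝔤 simple"), (2.6) p0010 L28–L31] -/
theorem IsJordanLefschetzPair.map_lieIdealProj (J : IsJordanLefschetzPair K h) (hII' : IsCompl I I') (hI : I ≠ ⊥) :
    IsJordanLefschetzPair K (lieIdealProj hII' h) :=
  haveI : FiniteDimensional K I := inferInstanceAs (FiniteDimensional K (I : Submodule K L))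
  J.map_of_surjective (lieIdealProj hII') (lieIdealProj_surjective hII') (J.isLefschetzTriple.lieIdealProj_h_ne_zero hII' hI)

/-- The same for the second factor. [cite: LooijengaLunts1997, §1 (1.2) Lemma p0004 L94–L105] -/
theorem IsJordanLefschetzPair.map_lieIdealProj_symm (J : IsJordanLefschetzPair K h) (hII' : IsCompl I I') (hI' : I' ≠ ⊥) :
    IsJordanLefschetzPair K (lieIdealProj hII'.symm h) :=
  J.map_lieIdealProj hII'.symm hI'

end Literature.Algebra.Lie
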